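import Literature.Geometry.Lorentzian.CauchyProblem
import Literature.Geometry.Lorentzian.DevelopmentProofs
import Literature.Geometry.Lorentzian.LeviCivitaProofs
import Literature.Geometry.Lorentzian.ModelDataProofs
import HarnessLib

/-!
# The existence facts `choquetBruhat_geroch_exists_mghd` and `choquetBruhat_local_existence`
# are false as stated (misstatement certificate; the corrected statements)

`Literature.Geometry.Lorentzian.CauchyProblem` vendors, as named facts (D-0014), the two
*existence* clauses of **gr.S12**:

* `choquetBruhat_geroch_exists_mghd` — the Choquet-Bruhat–Geroch theorem: every smooth vacuum
  initial data set solving the constraints has a maximal globally hyperbolic vacuum development,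
  `∀ [T2Space X] [SecondCountableTopology X] (D : InitialDataSet (𝓡 3) X) [D.metric.HasLeviCivita],
  D.IsVacuumConstraintSolution → ∃ 𝒟 : VacuumDevelopment D, 𝒟.IsMaximal`
  [cite: Ringstrom2009, Thm. 16.6]; the printed statements are

  > Choquet-Bruhat–Geroch, Comm. Math. Phys. 14 (1969), Thm. 3, p. 332: "Let S be an initial
  > data set. Then there exists a development M of S which is an extension of every other
  > development of S. This development is unique (up to isometry)."
  > Sbierski, Ann. Henri Poincaré 17 (2016), Thm. 2.6 (= arXiv:1309.7591, Thm. 6, "Existence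
  > of MGHD"): "Given initial data there exists a GHD M̃ that is an extension of any other GHD of
  > the same initial data. The GHD M̃ is unique up to isometry and is called the maximal globally
  > hyperbolic development (MGHD) of the given initial data."

* `choquetBruhat_local_existence` — Fourès-Bruhat's local existence theorem,
  `… D.IsVacuumConstraintSolution → Nonempty (VacuumDevelopment D)`
  [cite: Ringstrom2009, Thm. 14.2 and Cor. 16.4]; printed as Choquet-Bruhat–Geroch 1969, Thm. 1,
  p. 331: "Every initial data set has a development"; Sbierski 2016, Thm. 2.4.

This file records, in Lean, that **neither fact can be discharged, because both are false as
stated** (`not_choquetBruhat_geroch_exists_mghd`, `not_choquetBruhat_local_existence`), why, what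
each vendored statement actually says (`choquetBruhat_geroch_exists_mghd_iff`,
`choquetBruhat_local_existence_iff`: "`X` carries no smooth solution of the vacuum constraint
equations"), and what the corrected statements are. It is the companion, for the two `∃`-facts,
of `DevelopmentProofs` (the structure `Development D` is uninhabited), `CauchyProblemProofs`
(the `∀`-facts `mghd_unique`, `penrose_singularity_theorem` hold vacuously) and
`MinkowskiCauchyDefect` (the same certificate for `Minkowski.isCauchySurface_range_sliceEmbed`).
**It is a defect record with its bookkeeping consequences, not a rendering of a printed result**:
the printed theorems are true.

## The discrepancy

A development `𝒟 : VacuumDevelopment D` (`Development.lean`) carries the field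
`isCauchySurface : metric.IsCauchySurface timeOrientation (range embed)`, Choquet-Bruhat–Geroch's
footnote 5 (p. 331): "every timelike curve in M, without endpoint, must intersect S once and only
once". The vendored `LorentzianMetric.IsCauchySurface` (`Causality`) renders "without endpoint"
through `IsFutureInextendible`/`IsPastInextendible`, under which every timelike curve with
unbounded parameter set counts as inextendible — even a reparametrised short segment converging at
both ends, which can be cut to miss any given set. Hence the notion is uninhabited on every
nonempty manifold (`LorentzianMetric.IsCauchySurface.isEmpty`, `CausalityProofs`), the carrier of
a development is empty, and, `X` being connected hence nonempty, **there is no development of any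
data set at all** (`Development.elim`, `VacuumDevelopment.isEmpty`, `DevelopmentProofs`). On the
other hand the hypotheses of both facts are met: the trivial data `(ℝ³, δ, 0)` on the Minkowski
slice `Minkowski.slice = {t = 0} ≅ ℝ³` (`trivialData`, `ModelData`) solve the vacuum constraints
(`trivialData_isVacuumConstraintSolution_holds`, `ModelDataProofs`), and the standing Levi-Civita
hypothesis `[D.metric.HasLeviCivita]` holds for every smooth metric
(`PseudoRiemannianMetric.hasLeviCivita`, `LeviCivitaProofs`). So both facts fail at
`X = Minkowski.slice`; in general each is *equivalent* to the absence of vacuum data on `X`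
(`choquetBruhat_geroch_exists_mghd_iff`, `choquetBruhat_local_existence_iff`), and the two facts
are equivalent to each other (`choquetBruhat_geroch_exists_mghd_iff_local_existence`) — none of
which has anything to do with the Cauchy problem.

## The corrected statements (recorded; not declared here)

`CauchyDevelopment.lean` carries the repaired structures over the corrected notion
`LorentzianMetric.IsCauchyHypersurface` (O'Neill 1983, Ch. 14, Def. 14.28 with endless = without
endpoint; inhabited: `Minkowski.isCauchyHypersurface_range_sliceEmbed`, `MinkowskiCauchy`):
`CauchyDevelopment D`, `VacuumCauchyDevelopment D`, `VacuumCauchyDevelopment.IsMaximal`. The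
faithful renderings of the two printed theorems are the vendored statements *verbatim* with
`VacuumDevelopment ↦ VacuumCauchyDevelopment`, in the `Σ`-context of `CauchyProblem.lean`
(`{X : Type} [TopologicalSpace X] [ChartedSpace E3 X] [IsManifold (𝓡 3) ∞ X] [ConnectedSpace X]`):

* (gr.S12, existence of the MGHD; Choquet-Bruhat–Geroch 1969, Thm. 3; Ringström 2009, Thm. 16.6;
  Sbierski 2016, Thm. 2.6)
  `∀ [T2Space X] [SecondCountableTopology X] (D : InitialDataSet (𝓡 3) X) [D.metric.HasLeviCivita],
     D.IsVacuumConstraintSolution → ∃ 𝒟 : VacuumCauchyDevelopment D, 𝒟.IsMaximal`;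
* (local existence; Fourès-Bruhat 1952; Choquet-Bruhat–Geroch 1969, Thm. 1; Ringström 2009,
  Thm. 14.2 and Cor. 16.4; Sbierski 2016, Thm. 2.4)
  `∀ [T2Space X] [SecondCountableTopology X] (D : InitialDataSet (𝓡 3) X) [D.metric.HasLeviCivita],
     D.IsVacuumConstraintSolution → Nonempty (VacuumCauchyDevelopment D)`.

They are deliberately *not* declared in this file: under D-0026 a proving seat may not add an
unproved named fact, and their proofs — quasilinear wave equations in harmonic gauge with
constraint propagation and patching (Ringström 2009, Ch. 9 and Ch. 14), local geometric
uniqueness (Choquet-Bruhat–Geroch 1969, Thm. 2), and the gluing of all globally hyperbolic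
developments along maximal common sub-developments with the Hausdorff argument
(Choquet-Bruhat–Geroch 1969, pp. 332–335; Sbierski 2016, §3) — have no carrier in Mathlib or
`Literature` at the pin (no hyperbolic PDE theory, no quotient-manifold construction). The
uniqueness clause over the repaired structure is reduced to rigidity in `CauchyProblemCauchy`
(`VacuumCauchyDevelopment.isIsometricTo_of_isMaximal`). No named fact is introduced or consumed
here. `CauchyProblem.lean` keeps both `def`s with their statements unchanged (D-0014: no
in-place change of meaning); since the verdict clean-up of 2026-08-15 they are marked
`@[deprecated]` there, with this file's theorems as their documented refutations — which is why
`linter.deprecated` is switched off below: every declaration of this file must name them.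

## References

* Y. Choquet-Bruhat, R. Geroch, *Global aspects of the Cauchy problem in general relativity*,
  Comm. Math. Phys. 14 (1969), 329–335: developments and footnote 5 (p. 331), Thm. 1 (p. 331),
  Thm. 3 (p. 332).
* J. Sbierski, *On the existence of a maximal Cauchy development for the Einstein equations: a
  dezornification*, Ann. Henri Poincaré 17 (2016), 301–329 (= arXiv:1309.7591): Def. 2.1–2.2,
  Thm. 2.4, Thm. 2.6.
* H. Ringström, *The Cauchy Problem in General Relativity*, EMS 2009, Thm. 14.2, Cor. 16.4,
  Def. 16.1–16.5, Thm. 16.6.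
* Y. Fourès-Bruhat, *Théorème d'existence pour certains systèmes d'équations aux dérivées
  partielles non linéaires*, Acta Math. 88 (1952), 141–225.
* B. O'Neill, *Semi-Riemannian geometry with applications to relativity*, Academic Press 1983,
  Ch. 14, Def. 14.28 (p. 415).
-/

noncomputable section

open Set
open scoped Manifold ContDiff

-- Every theorem below is *about* the two deprecated (2026-08-15) renderings
-- `choquetBruhat_geroch_exists_mghd` / `choquetBruhat_local_existence` and must name them:
-- the deprecation warning is silenced for this file (its statements are their refutations).
set_option linter.deprecated false

namespace Literature.Geometry.Lorentzian

section CauchyProblem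

variable {X : Type} [TopologicalSpace X] [ChartedSpace E3 X] [IsManifold (𝓡 3) ∞ X]
  [ConnectedSpace X]

/-! ### What the two vendored existence facts say -/

/-- **A data manifold carrying a solution of the vacuum constraints refutes
`choquetBruhat_geroch_exists_mghd`.** If `X` (connected, Hausdorff, second countable) carries a
smooth initial data set `D` solving the vacuum constraint equations, the vendored fact fails on
`X`: it would produce a vacuum development `𝒟 : VacuumDevelopment D`, and there is none
(`Development.elim`, `DevelopmentProofs`: the Cauchy-surface field of a development is the
uninhabited vendored notion `LorentzianMetric.IsCauchySurface`). Contrast the printed theorem,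
Choquet-Bruhat–Geroch 1969, Thm. 3 (p. 332), which asserts that such a (maximal) development
exists. A misstatement certificate, not a rendering of a printed result.
[cite: ChoquetBruhatGeroch1969CMP, Thm. 3 (p. 332)] -/
theorem not_choquetBruhat_geroch_exists_mghd_of_isVacuumConstraintSolution [T2Space X]
    [SecondCountableTopology X] (D : InitialDataSet (𝓡 3) X) [D.metric.HasLeviCivita]
    (hD : D.IsVacuumConstraintSolution) : ¬ choquetBruhat_geroch_exists_mghd (X := X) := by
  intro h
  obtain ⟨𝒟, -⟩ := h D hD
  exact 𝒟.toDevelopment.elim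

/-- **A data manifold carrying a solution of the vacuum constraints refutes
`choquetBruhat_local_existence`**: the fact would produce an inhabitant of the empty type
`VacuumDevelopment D` (`VacuumDevelopment.isEmpty`, `DevelopmentProofs`). Contrast
Choquet-Bruhat–Geroch 1969, Thm. 1 (p. 331): "Every initial data set has a development."
A misstatement certificate, not a rendering of a printed result.
[cite: ChoquetBruhatGeroch1969CMP, Thm. 1 (p. 331)] -/
theorem not_choquetBruhat_local_existence_of_isVacuumConstraintSolution [T2Space X]
    [SecondCountableTopology X] (D : InitialDataSet (𝓡 3) X) [D.metric.HasLeviCivita]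
    (hD : D.IsVacuumConstraintSolution) : ¬ choquetBruhat_local_existence (X := X) := by
  intro h
  obtain ⟨𝒟⟩ := h D hD
  exact 𝒟.toDevelopment.elim

/-- **What `choquetBruhat_geroch_exists_mghd` actually says**: on the connected `3`-manifold `X`
the vendored fact holds if and only if `X` carries *no* smooth initial data set solving the
vacuum constraint equations (with Hausdorff and second-countability and the standing Levi-Civita
hypothesis bound as in the fact) — because the conclusion `∃ 𝒟 : VacuumDevelopment D, …` is
unsatisfiable (`Development.elim`). This is unrelated to the printed theorem
(Choquet-Bruhat–Geroch 1969, Thm. 3, p. 332; Ringström 2009, Thm. 16.6), which is why the fact is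
re-vendored over `VacuumCauchyDevelopment` (module docstring). A misstatement certificate.
[cite: ChoquetBruhatGeroch1969CMP, Thm. 3 (p. 332)] -/
theorem choquetBruhat_geroch_exists_mghd_iff :
    choquetBruhat_geroch_exists_mghd (X := X) ↔
      ∀ [T2Space X] [SecondCountableTopology X] (D : InitialDataSet (𝓡 3) X)
        [D.metric.HasLeviCivita], ¬ D.IsVacuumConstraintSolution := by
  constructor
  · intro h _ _ D _ hD
    obtain ⟨𝒟, -⟩ := h D hD
    exact 𝒟.toDevelopment.elim
  · intro h _ _ D _ hD
    exact absurd hD (h D)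

/-- **What `choquetBruhat_local_existence` actually says**: the vendored fact holds on `X` if and
only if `X` carries no smooth solution of the vacuum constraints (`VacuumDevelopment D` is empty,
`VacuumDevelopment.isEmpty`). Contrast Choquet-Bruhat–Geroch 1969, Thm. 1 (p. 331). A
misstatement certificate. [cite: ChoquetBruhatGeroch1969CMP, Thm. 1 (p. 331)] -/
theorem choquetBruhat_local_existence_iff :
    choquetBruhat_local_existence (X := X) ↔
      ∀ [T2Space X] [SecondCountableTopology X] (D : InitialDataSet (𝓡 3) X)
        [D.metric.HasLeviCivita], ¬ D.IsVacuumConstraintSolution := by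
  constructor
  · intro h _ _ D _ hD
    obtain ⟨𝒟⟩ := h D hD
    exact 𝒟.toDevelopment.elim
  · intro h _ _ D _ hD
    exact absurd hD (h D)

/-- Under the vendored (defective) development structure the MGHD-existence fact and the
local-existence fact are **equivalent** — both say "no vacuum data on `X`"
(`choquetBruhat_geroch_exists_mghd_iff`, `choquetBruhat_local_existence_iff`); in print the first
is the deep globalisation of the second (Choquet-Bruhat–Geroch 1969, Thm. 3 from Thms. 1–2,
pp. 332–335). A misstatement certificate. [cite: ChoquetBruhatGeroch1969CMP, Thms. 1–3 (pp. 331–332)] -/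
theorem choquetBruhat_geroch_exists_mghd_iff_local_existence :
    choquetBruhat_geroch_exists_mghd (X := X) ↔ choquetBruhat_local_existence (X := X) :=
  choquetBruhat_geroch_exists_mghd_iff.trans choquetBruhat_local_existence_iff.symm

end CauchyProblem

/-! ### The two facts are false: the Minkowski slice carries vacuum data -/

/-- **The named fact `choquetBruhat_geroch_exists_mghd` is false as stated**: it fails on the
Minkowski slice `Minkowski.slice = {t = 0} ≅ ℝ³` (connected, Hausdorff, second countable), which
carries the trivial data `(ℝ³, δ, 0)` (`trivialData`) solving the vacuum constraints
(`trivialData_isVacuumConstraintSolution_holds`, `ModelDataProofs`; the Levi-Civita hypothesis is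
`PseudoRiemannianMetric.hasLeviCivita`), while no data set has a development in the vendored
sense (`not_choquetBruhat_geroch_exists_mghd_of_isVacuumConstraintSolution`). The printed theorem
(Choquet-Bruhat–Geroch 1969, Thm. 3, p. 332; Ringström 2009, Thm. 16.6; Sbierski 2016, Thm. 2.6)
is true; in particular Minkowski spacetime is the MGHD of these data. The corrected statement,
over `VacuumCauchyDevelopment`, is recorded in the module docstring. A misstatement certificate,
not a rendering of a printed result. [cite: ChoquetBruhatGeroch1969CMP, Thm. 3 (p. 332)] -/
theorem not_choquetBruhat_geroch_exists_mghd :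
    ¬ choquetBruhat_geroch_exists_mghd (X := Minkowski.slice) := by
  haveI := trivialData.metric.hasLeviCivita
  have hD : trivialData.IsVacuumConstraintSolution := trivialData_isVacuumConstraintSolution_holds
  exact not_choquetBruhat_geroch_exists_mghd_of_isVacuumConstraintSolution trivialData hD

/-- **The named fact `choquetBruhat_local_existence` is false as stated**: it fails on the
Minkowski slice with the trivial data `(ℝ³, δ, 0)` (`trivialData_isVacuumConstraintSolution_holds`,
`not_choquetBruhat_local_existence_of_isVacuumConstraintSolution`). The printed theorem
(Fourès-Bruhat 1952; Choquet-Bruhat–Geroch 1969, Thm. 1, p. 331; Ringström 2009, Thm. 14.2 and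
Cor. 16.4) is true; the corrected statement, over `VacuumCauchyDevelopment`, is recorded in the
module docstring. A misstatement certificate, not a rendering of a printed result.
[cite: ChoquetBruhatGeroch1969CMP, Thm. 1 (p. 331)] -/
theorem not_choquetBruhat_local_existence :
    ¬ choquetBruhat_local_existence (X := Minkowski.slice) := by
  haveI := trivialData.metric.hasLeviCivita
  have hD : trivialData.IsVacuumConstraintSolution := trivialData_isVacuumConstraintSolution_holds
  exact not_choquetBruhat_local_existence_of_isVacuumConstraintSolution trivialData hD

/-- Equivalent form of `not_choquetBruhat_geroch_exists_mghd`: at `X = Minkowski.slice` the named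
fact `choquetBruhat_geroch_exists_mghd` is equivalent to `False`, so no discharge
`choquetBruhat_geroch_exists_mghd_holds` (which must hold at every `X`) can exist. Contrast
Choquet-Bruhat–Geroch 1969, Thm. 3 (p. 332). A misstatement certificate.
[cite: ChoquetBruhatGeroch1969CMP, Thm. 3 (p. 332)] -/
theorem choquetBruhat_geroch_exists_mghd_iff_false :
    choquetBruhat_geroch_exists_mghd (X := Minkowski.slice) ↔ False :=
  iff_false_intro not_choquetBruhat_geroch_exists_mghd

/-- Equivalent form of `not_choquetBruhat_local_existence`: at `X = Minkowski.slice` the named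
fact `choquetBruhat_local_existence` is equivalent to `False`. Contrast Choquet-Bruhat–Geroch
1969, Thm. 1 (p. 331). A misstatement certificate. [cite: ChoquetBruhatGeroch1969CMP, Thm. 1 (p. 331)] -/
theorem choquetBruhat_local_existence_iff_false :
    choquetBruhat_local_existence (X := Minkowski.slice) ↔ False :=
  iff_false_intro not_choquetBruhat_local_existence

end Literature.Geometry.Lorentzian

end
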